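import Mathlib
import Summits.Ventures.PercRepro2.Defs
import Summits.Ventures.PercRepro2.Harris
import Summits.Ventures.PercRepro2.Graph

/-!
# Side signs in the complementary model are increasing; Harris gives their positive correlation
(blind cell PercRepro2, mine-1 g14; proofs/MINE1-WBERN.md §9)

The COMPLEMENTARY MODEL of a typed base `n : E → ℕ` (the cell's typed bases: `n e = 2` — open in both
copies, `n e = 0` — closed in both, `n e = 1` — open in exactly one copy) reads the two copies off ONE
configuration `ω`: `copy1 n ω` follows `ω` on the type-1 edges, `copy2 n ω` follows its complement.
The SIDE SIGN of a vertex `x`, `sideSign = 1[x ∈ C(copy1)] − 1[x ∈ C(copy2)]`, is an INCREASING function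
of `ω` (the first cluster grows with `ω`, the second shrinks), and it is odd under the complement
`ω ↦ !ω`, which swaps the two copies and preserves the uniform weight `p ≡ ½`. Hence, by the cell's
Harris inequality, `E_½[sideSign x · sideSign y] ≥ E_½[sideSign x] · E_½[sideSign y] = 0`
(`expect_half_sideSign_mul_nonneg`): the typed-base coefficients of the two-vertex W-form
`W_{xy} W_∅ − W_x W_y` without avoided vertices are nonnegative — the one case of (W-BERN) that is
Harris (MINE1-WBERN.md §9); the «not both» constraints of further test vertices and the avoided set
are exactly what Harris does not cover.
-/

namespace Summit.Ventures.PercRepro2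

namespace CompHarris

open scoped Classical

section Copies

variable {E : Type*} [Fintype E] [DecidableEq E]

/-- Copy 1 of the typed base `n` read from `ω`: type-2 edges open, type-0 closed, type-1 follow `ω`. -/
def copy1 (n : E → ℕ) (ω : Config E) : Config E :=
  fun e => if n e = 2 then true else if n e = 0 then false else ω e

/-- Copy 2: type-2 edges open, type-0 closed, type-1 follow the complement of `ω`. -/
def copy2 (n : E → ℕ) (ω : Config E) : Config E :=
  fun e => if n e = 2 then true else if n e = 0 then false else !(ω e)

/-- The complement of a configuration. -/
def compl (ω : Config E) : Config E := fun e => !(ω e)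

omit [Fintype E] [DecidableEq E] in
/-- Copy 1 is increasing in `ω`. -/
lemma copy1_mono (n : E → ℕ) : Monotone (copy1 n) := by
  intro ω ω' h e
  unfold copy1
  split_ifs <;> simp [h e]

omit [Fintype E] [DecidableEq E] in
/-- Copy 2 is decreasing in `ω`. -/
lemma copy2_anti (n : E → ℕ) : Antitone (copy2 n) := by
  intro ω ω' h e
  unfold copy2
  split_ifs
  · exact le_refl _
  · exact le_refl _
  · have := h e
    cases hω : ω e <;> cases hω' : ω' e <;> simp_all

omit [Fintype E] [DecidableEq E] in
/-- Complementing `ω` turns copy 1 into copy 2. -/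
lemma copy1_compl (n : E → ℕ) (ω : Config E) : copy1 n (compl ω) = copy2 n ω := by
  funext e; unfold copy1 copy2 compl; rfl

omit [Fintype E] [DecidableEq E] in
/-- Complementing `ω` turns copy 2 into copy 1. -/
lemma copy2_compl (n : E → ℕ) (ω : Config E) : copy2 n (compl ω) = copy1 n ω := by
  funext e; unfold copy1 copy2 compl
  split_ifs <;> simp

omit [Fintype E] [DecidableEq E] in
/-- The complement is an involution. -/
lemma compl_compl (ω : Config E) : compl (compl ω) = ω := by
  funext e; unfold compl; simp

omit [Fintype E] [DecidableEq E] in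
/-- The complement is an involution (bundled form). -/
lemma compl_involutive : Function.Involutive (compl : Config E → Config E) := compl_compl

end Copies

section SideSign

variable {V : Type*} {E : Type*} [Fintype E] [DecidableEq E] [Fintype V] [DecidableEq V]
  {R : Type*} [Field R] [LinearOrder R] [IsStrictOrderedRing R]

variable (ends : E → Sym2 V) (s : V)

/-- The side sign of `x` at the typed base `n`: `+1` if `x` lies in the cluster of copy 1 only,
`−1` if in copy 2 only, `0` otherwise (both or neither). -/
noncomputable def sideSign (x : V) (n : E → ℕ) (ω : Config E) : R :=
  (if x ∈ cluster ends (copy1 n ω) s then 1 else 0) -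
    (if x ∈ cluster ends (copy2 n ω) s then 1 else 0)

omit [Fintype E] [DecidableEq E] [Fintype V] [DecidableEq V] in
/-- Indicators of cluster membership are monotone in the configuration. -/
lemma monotone_indicator_cluster (x : V) :
    Monotone (fun ω : Config E => if x ∈ cluster ends ω s then (1 : R) else 0) := by
  intro ω ω' h
  show (if x ∈ cluster ends ω s then (1 : R) else 0) ≤ (if x ∈ cluster ends ω' s then (1 : R) else 0)
  by_cases hx : x ∈ cluster ends ω s
  · have hx' : x ∈ cluster ends ω' s := cluster_mono h s hx
    rw [if_pos hx, if_pos hx']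
  · rw [if_neg hx]
    split_ifs <;> norm_num

omit [Fintype E] [DecidableEq E] [Fintype V] [DecidableEq V] in
/-- **The side sign is increasing in `ω`.** -/
lemma monotone_sideSign (x : V) (n : E → ℕ) : Monotone (sideSign ends s x n (R := R)) := by
  intro ω ω' h
  unfold sideSign
  have h1 := monotone_indicator_cluster ends s (R := R) x (copy1_mono n h)
  have h2 := monotone_indicator_cluster ends s (R := R) x (copy2_anti n h)
  exact sub_le_sub h1 h2

omit [Fintype E] [DecidableEq E] [Fintype V] [DecidableEq V] [LinearOrder R] [IsStrictOrderedRing R] in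
/-- **The side sign is odd under the complement.** -/
lemma sideSign_compl (x : V) (n : E → ℕ) (ω : Config E) :
    sideSign ends s x n (compl ω) = -(sideSign ends s x n ω : R) := by
  unfold sideSign
  rw [copy1_compl, copy2_compl]
  ring

/-- The uniform weight vector `p ≡ ½`. -/
noncomputable def half : E → R := fun _ => (1 / 2 : R)

omit [Fintype E] [DecidableEq E] [Fintype V] [DecidableEq V] in
/-- `½` is an admissible weight vector. -/
lemma isProbVec_half : IsProbVec (half : E → R) :=
  ⟨fun _ => by unfold half; positivity, fun _ => by unfold half; linarith [one_half_lt_one (α := R)]⟩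

omit [DecidableEq E] [Fintype V] [DecidableEq V] in
/-- The uniform weight is invariant under the complement. -/
lemma weight_half_compl (ω : Config E) : weight (half : E → R) (compl ω) = weight half ω := by
  unfold weight
  refine Finset.prod_congr rfl fun e _ => ?_
  unfold half compl edgeFactor
  cases ω e <;> simp <;> ring

omit [Fintype V] [DecidableEq V] in
/-- The expectation under the uniform weight is invariant under the complement. -/
lemma expect_half_comp_compl (f : Config E → R) :
    expect (half : E → R) (fun ω => f (compl ω)) = expect half f := by
  unfold expect
  have hsum := Equiv.sum_comp (Function.Involutive.toPerm compl compl_involutive)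
    (fun ω => weight (half : E → R) ω * f ω)
  simp only [Function.Involutive.coe_toPerm] at hsum
  rw [← hsum]
  refine Finset.sum_congr rfl fun ω _ => ?_
  rw [weight_half_compl]

omit [Fintype V] [DecidableEq V] in
/-- An odd function has zero mean under the uniform weight. -/
lemma expect_half_eq_zero_of_odd {f : Config E → R} (hf : ∀ ω, f (compl ω) = -f ω) :
    expect (half : E → R) f = 0 := by
  have h := expect_half_comp_compl (f := f)
  simp_rw [hf] at h
  have h2 : expect (half : E → R) (fun ω => -f ω) = -expect half f := by
    unfold expect; simp [Finset.sum_neg_distrib]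
  linarith

omit [Fintype V] [DecidableEq V] in
/-- The side sign has zero mean under the uniform weight. -/
lemma expect_half_sideSign (x : V) (n : E → ℕ) :
    expect (half : E → R) (sideSign ends s x n) = 0 :=
  expect_half_eq_zero_of_odd (fun ω => sideSign_compl ends s x n ω)

omit [Fintype V] [DecidableEq V] in
/-- **Harris in the complementary model**: the side signs of two vertices are positively correlated
under the uniform weight, at every typed base — the typed-base coefficients of the two-vertex W-form
`W_{xy}W_∅ − W_xW_y` (no avoided vertex) are nonnegative. -/
theorem expect_half_sideSign_mul_nonneg (x y : V) (n : E → ℕ) :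
    0 ≤ expect (half : E → R) (sideSign ends s x n * sideSign ends s y n) := by
  have h := expect_mul_expect_le_expect_mul (isProbVec_half (E := E) (R := R))
    (monotone_sideSign ends s (R := R) x n) (monotone_sideSign ends s (R := R) y n)
  rw [expect_half_sideSign, expect_half_sideSign, mul_zero] at h
  exact h

end SideSign

end CompHarris

end Summit.Ventures.PercRepro2
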